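import Summits.AtomisticToContinuum.Crystallization.Theorems.FreeSplittingCertificatesRadiusLadderStar902
import Summits.AtomisticToContinuum.Crystallization.Theorems.FreeSplittingCertificatesRadiusLadderApprox

/-!
# `FiniteRangeSplitting` (stmt-AtomisticToContinuum-12559): the threshold is attained, and the crux is one number

Support file for crux r2 (and r5) of route `FreeSplittingCertificates` (block-2b unit `b2b-freesplit-A`, gen 14).
VALUE = theorems about the crux (a closedness lemma and an exact reformulation) — NOT summit progress.

## 1. The half-rule threshold `δ_½` is attained (scaling closure)

`…RadiusLadderThreshold` left open whether `halfSumThreshold = δ_½ := inf {δ | HalfSumFeasible δ}` is itself feasible.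
It is: the truth set `{δ | HalfSumFeasible δ}` is CLOSED under limits from above, because a `δ`-separated configuration
`x` rescaled by `c > 1` is `cδ`-separated, the deepest-site inequality at `c • x` reads `e_∞ ≤ ½ Σ_j V(c·r_ij)`, and
`c ↦ V(c·r)` is continuous at `c = 1` for `r ≠ 0` (`halfSumFeasible_of_forall_gt`).  Hence
`HalfSumFeasible δ ↔ δ_½ ≤ δ` EXACTLY (`halfSumFeasible_iff_threshold_le`), `{δ | HalfSumFeasible δ} = [δ_½, ∞)`, the half
rule is a rung at `δ_½` itself (`rungAt_halfSumThreshold`), and for `0 < R < δ` the rung is decided by the closed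
inequality `RungAt δ R ↔ δ_½ ≤ δ` with no exceptional point (`rungAt_iff_threshold_le_of_lt`, removing the hypothesis
`δ ≠ δ_½` of `rungAt_iff_threshold_lt`).  With the tree bracket `47/50 ≤ δ_½ ≤ 6/5` (`…RadiusLadderStar902`,
`…RadiusLadderHalfRule65`; the numeric corollaries are in the companion file `…RadiusLadderCritical65`) this is the
complete answer for small radii.

## 2. The crux as the vanishing of one real number

`RungSet := {δ > 0 | ∃ R > 0, RungAt δ R}` is an up-set of positive reals containing `[δ_½, ∞)`; its infimum
`critSep := inf RungSet ∈ [0, δ_½]` is the CRITICAL HARD CORE of finite-range pair splitting, and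

  `FiniteRangeSplitting ↔ critSep = 0`            (`finiteRangeSplitting_iff_critSep_eq_zero`),
  `0 < critSep ↔ ∃ δ > 0, ∀ R > 0, ¬ RungAt δ R`   (`critSep_pos_iff`).

Equivalently the crux only has content in the window `(0, δ_½)`, and there every witness must READ NEIGHBOURS:
`FiniteRangeSplitting ↔ ∀ δ ∈ (0, δ_½), ∃ R ≥ δ, RungAt δ R` (`finiteRangeSplitting_iff_window`), the rule being
necessarily different from the half rule (`finiteRangeSplitting_window_nonconstant`).  The `ε`-analogue for crux r5:
`ApproxFiniteRangeSplitting ↔ ∀ ε > 0, critSepApprox ε = 0` with `critSepApprox ε ≤ critSep`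
(`approxFiniteRangeSplitting_iff_critSepApprox`).

Whether `critSep ∈ RungSet` (attainment for general rules) is NOT claimed: the scaling argument of §1 uses that the half
rule is scale-free, which a pattern-reading rule at radius `R` is not.
-/

noncomputable section

namespace Summit.AtomisticToContinuum.Crystallization.Theorems.StrictSplittingRuleBirth

open scoped BigOperators Classical Topology
open Filter Literature.MathematicalPhysics.StatisticalMechanics

/-! ## 1. Scaling closure: `δ_½` is attained -/

/-- Rescaling a `δ`-separated configuration by `c ≥ 0` gives a `cδ`-separated one. [folklore] -/
theorem sep_smul_of_nonneg {δ c : ℝ} (hc : 0 ≤ c) {N : ℕ} {x : Fin N → EuclideanSpace ℝ (Fin 3)}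
    (hx : Sep δ x) : Sep (c * δ) (fun k => c • x k) := by
  intro i j hij
  show c * δ ≤ dist (c • x i) (c • x j)
  rw [dist_smul₀, Real.norm_of_nonneg hc]
  exact mul_le_mul_of_nonneg_left (hx i j hij) hc

/-- `c ↦ V(c·r)` is continuous at `c = 1` when `r ≠ 0`. [folklore] -/
theorem continuousAt_lennardJones_mul {r : ℝ} (hr : r ≠ 0) :
    ContinuousAt (fun c : ℝ => lennardJones (c * r)) 1 := by
  have hmul : ContinuousAt (fun c : ℝ => c * r) 1 := (continuous_mul_const r).continuousAt
  have h1 : ContinuousAt lennardJones ((fun c : ℝ => c * r) 1) := by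
    refine continuousOn_lennardJones.continuousAt (isOpen_compl_singleton.mem_nhds ?_)
    simpa using hr
  exact ContinuousAt.comp (f := fun c : ℝ => c * r) (x := (1 : ℝ)) h1 hmul

/-- **Scaling closure of the deepest-site inequality.**  If `HalfSumFeasible δ'` for every `δ' > δ > 0`, then
`HalfSumFeasible δ`: rescale by `c > 1` and let `c → 1⁺`. [folklore] -/
theorem halfSumFeasible_of_forall_gt {δ : ℝ} (hδ : 0 < δ) (h : ∀ δ' : ℝ, δ < δ' → HalfSumFeasible δ') :
    HalfSumFeasible δ := by
  intro N x hx i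
  set f : ℝ → ℝ := fun c => (∑ j ∈ Finset.univ.erase i, lennardJones (c * dist (x i) (x j))) / 2 with hf
  have hfc : ∀ c : ℝ, 1 < c → eInf ≤ f c := by
    intro c hc
    have hc0 : 0 ≤ c := by linarith
    have hδ' : δ < c * δ := by nlinarith
    have key := h (c * δ) hδ' N (fun k => c • x k) (sep_smul_of_nonneg hc0 hx) i
    simpa [hf, dist_smul₀, Real.norm_of_nonneg hc0] using key
  have hlim : Tendsto f (𝓝[>] (1 : ℝ)) (𝓝 (f 1)) := by
    have hsum : ContinuousAt (fun c : ℝ => ∑ j ∈ Finset.univ.erase i, lennardJones (c * dist (x i) (x j))) 1 := by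
      refine tendsto_finsetSum _ fun j hj => ?_
      have hne : dist (x i) (x j) ≠ 0 := by
        have hij : i ≠ j := (Finset.ne_of_mem_erase hj).symm
        exact ne_of_gt (hδ.trans_le (hx i j hij))
      exact continuousAt_lennardJones_mul hne
    exact (hsum.div_const 2).continuousWithinAt.tendsto
  have hev : ∀ᶠ c in 𝓝[>] (1 : ℝ), eInf ≤ f c := eventually_nhdsWithin_of_forall fun c hc => hfc c hc
  have hle : eInf ≤ f 1 := ge_of_tendsto hlim hev
  simpa [hf] using hle

/-- `0 < δ_½` (indeed `47/50 ≤ δ_½`). -/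
theorem halfSumThreshold_pos : 0 < halfSumThreshold :=
  lt_of_lt_of_le (by norm_num) le_halfSumThreshold_47_50

/-- **`δ_½` is attained**: the deepest-site inequality holds AT the threshold. -/
theorem halfSumFeasible_halfSumThreshold : HalfSumFeasible halfSumThreshold :=
  halfSumFeasible_of_forall_gt halfSumThreshold_pos fun _ h => halfSumFeasible_of_threshold_lt h

/-- **Exact characterisation**: `HalfSumFeasible δ ↔ δ_½ ≤ δ`. -/
theorem halfSumFeasible_iff_threshold_le {δ : ℝ} : HalfSumFeasible δ ↔ halfSumThreshold ≤ δ :=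
  ⟨halfSumThreshold_le_of, fun h => halfSumFeasible_mono h halfSumFeasible_halfSumThreshold⟩

/-- The truth set of the deepest-site inequality is the closed ray `[δ_½, ∞)`. -/
theorem setOf_halfSumFeasible_eq_Ici : {δ : ℝ | HalfSumFeasible δ} = Set.Ici halfSumThreshold :=
  Set.ext fun _ => halfSumFeasible_iff_threshold_le

/-- `δ_½` is the LEAST feasible hard core (a minimum, not only an infimum). -/
theorem isLeast_halfSumThreshold : IsLeast {δ : ℝ | HalfSumFeasible δ} halfSumThreshold :=
  ⟨halfSumFeasible_halfSumThreshold, fun _ h => halfSumThreshold_le_of h⟩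

/-- The half rule is feasible exactly from `δ_½` on, at every radius. -/
theorem feasible_halfRule_iff_threshold_le (δ R : ℝ) : Feasible δ R halfRule ↔ halfSumThreshold ≤ δ := by
  rw [feasible_halfRule_iff, halfSumFeasible_iff_threshold_le]

/-- `RungAt δ_½ R` for every `R` (witness: the half rule). -/
theorem rungAt_halfSumThreshold (R : ℝ) : RungAt halfSumThreshold R :=
  rungAt_of_halfSumFeasible halfSumFeasible_halfSumThreshold R

/-- Every `δ ≥ δ_½` has every rung. -/
theorem rungAt_of_threshold_le {δ : ℝ} (h : halfSumThreshold ≤ δ) (R : ℝ) : RungAt δ R :=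
  rungAt_of_halfSumFeasible (halfSumFeasible_iff_threshold_le.2 h) R

/-- **Small radii, completely decided by one closed inequality**: for `0 < R < δ`, `RungAt δ R ↔ δ_½ ≤ δ`
(no exceptional point; compare `rungAt_iff_threshold_lt`). -/
theorem rungAt_iff_threshold_le_of_lt {δ R : ℝ} (hδ : 0 < δ) (hR : R < δ) :
    RungAt δ R ↔ halfSumThreshold ≤ δ := by
  rw [rungAt_iff_halfSumFeasible_of_lt hδ hR, halfSumFeasible_iff_threshold_le]

/-- Read back on crux r2: its `δ`-instances for `δ ≥ δ_½` are theorems. -/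
theorem exists_rung_of_threshold_le {δ : ℝ} (h : halfSumThreshold ≤ δ) : ∃ R : ℝ, 0 < R ∧ RungAt δ R :=
  ⟨1, one_pos, rungAt_of_threshold_le h 1⟩

/-! ## 2. The critical hard core `critSep` -/

/-- The hard cores carrying a rung at some positive radius. [folklore] -/
def RungSet : Set ℝ := {δ : ℝ | 0 < δ ∧ ∃ R : ℝ, 0 < R ∧ RungAt δ R}

/-- `RungSet` is an up-set. -/
theorem mem_rungSet_of_le {δ δ' : ℝ} (h : δ ∈ RungSet) (hle : δ ≤ δ') : δ' ∈ RungSet :=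
  ⟨h.1.trans_le hle, h.2.imp fun _ hR => ⟨hR.1, rungAt_mono_sep hle hR.2⟩⟩

/-- `[δ_½, ∞) ⊆ RungSet`. -/
theorem mem_rungSet_of_threshold_le {δ : ℝ} (h : halfSumThreshold ≤ δ) : δ ∈ RungSet :=
  ⟨halfSumThreshold_pos.trans_le h, exists_rung_of_threshold_le h⟩

/-- `RungSet` is nonempty (`δ_½ ∈ RungSet`). -/
theorem rungSet_nonempty : RungSet.Nonempty :=
  ⟨halfSumThreshold, mem_rungSet_of_threshold_le le_rfl⟩

/-- `RungSet` is bounded below by `0`. -/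
theorem rungSet_bddBelow : BddBelow RungSet :=
  ⟨0, fun _ h => h.1.le⟩

/-- **The critical hard core of finite-range pair splitting**: `δ_c := inf {δ > 0 | ∃ R > 0, RungAt δ R}`. [folklore] -/
def critSep : ℝ := sInf RungSet

/-- `0 ≤ δ_c`. -/
theorem critSep_nonneg : 0 ≤ critSep :=
  le_csInf rungSet_nonempty fun _ h => h.1.le

/-- Members of `RungSet` bound `δ_c` from above. -/
theorem critSep_le_of_mem {δ : ℝ} (h : δ ∈ RungSet) : critSep ≤ δ :=
  csInf_le rungSet_bddBelow h

/-- Every hard core strictly above `δ_c` carries a rung. -/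
theorem mem_rungSet_of_critSep_lt {δ : ℝ} (h : critSep < δ) : δ ∈ RungSet := by
  obtain ⟨s, hs, hsδ⟩ := (csInf_lt_iff rungSet_bddBelow rungSet_nonempty).mp h
  exact mem_rungSet_of_le hs hsδ.le

/-- No hard core strictly below `δ_c` carries a rung. -/
theorem not_mem_rungSet_of_lt_critSep {δ : ℝ} (h : δ < critSep) : δ ∉ RungSet :=
  fun hδ => not_lt.mpr (critSep_le_of_mem hδ) h

/-- Spelled out: for `0 < δ < δ_c` and every `R > 0`, `¬ RungAt δ R`. -/
theorem not_rungAt_of_lt_critSep {δ R : ℝ} (hδ : 0 < δ) (h : δ < critSep) (hR : 0 < R) : ¬ RungAt δ R :=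
  fun hr => not_mem_rungSet_of_lt_critSep h ⟨hδ, R, hR, hr⟩

/-- `δ_c ≤ δ_½`. -/
theorem critSep_le_halfSumThreshold : critSep ≤ halfSumThreshold :=
  critSep_le_of_mem (mem_rungSet_of_threshold_le le_rfl)

/-- **Crux r2 is the vanishing of the critical hard core**: `FiniteRangeSplitting ↔ δ_c = 0`. -/
theorem finiteRangeSplitting_iff_critSep_eq_zero :
    Summit.AtomisticToContinuum.Crystallization.Theses.FreeSplittingCertificates.FiniteRangeSplitting ↔
      critSep = 0 := by
  rw [finiteRangeSplitting_iff_rung]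
  constructor
  · intro h
    exact le_antisymm (le_of_forall_gt_imp_ge_of_dense fun δ hδ => critSep_le_of_mem ⟨hδ, h δ hδ⟩) critSep_nonneg
  · intro h δ hδ
    exact (mem_rungSet_of_critSep_lt (h ▸ hδ)).2

/-- **The negation of crux r2 is a positive critical hard core**: `0 < δ_c ↔ ∃ δ > 0, ∀ R > 0, ¬ RungAt δ R`. -/
theorem critSep_pos_iff : 0 < critSep ↔ ∃ δ : ℝ, 0 < δ ∧ ∀ R : ℝ, 0 < R → ¬ RungAt δ R := by
  constructor
  · intro h
    exact ⟨critSep / 2, half_pos h, fun R hR => not_rungAt_of_lt_critSep (half_pos h) (half_lt_self h) hR⟩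
  · rintro ⟨δ, hδ, hno⟩
    refine hδ.trans_le (le_csInf rungSet_nonempty fun s hs => ?_)
    by_contra hlt
    obtain ⟨R, hR, hr⟩ := (mem_rungSet_of_le hs (le_of_not_ge hlt)).2
    exact hno R hR hr

/-- `¬ FiniteRangeSplitting ↔ 0 < δ_c`. -/
theorem not_finiteRangeSplitting_iff_critSep_pos :
    ¬ Summit.AtomisticToContinuum.Crystallization.Theses.FreeSplittingCertificates.FiniteRangeSplitting ↔
      0 < critSep := by
  rw [finiteRangeSplitting_iff_critSep_eq_zero]
  exact ⟨fun h => lt_of_le_of_ne critSep_nonneg (Ne.symm h), fun h => h.ne'⟩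

/-- The crux only has content below any known member of `RungSet`. -/
theorem finiteRangeSplitting_iff_below {c : ℝ} (hc : c ∈ RungSet) :
    Summit.AtomisticToContinuum.Crystallization.Theses.FreeSplittingCertificates.FiniteRangeSplitting ↔
      ∀ δ : ℝ, 0 < δ → δ < c → ∃ R : ℝ, 0 < R ∧ RungAt δ R := by
  rw [finiteRangeSplitting_iff_rung]
  refine ⟨fun h δ hδ _ => h δ hδ, fun h δ hδ => ?_⟩
  rcases lt_or_ge δ c with hlt | hle
  · exact h δ hδ hlt
  · exact (mem_rungSet_of_le hc hle).2

/-- **The window form of crux r2**: it suffices (and is necessary) to find, for every hard core `δ ∈ (0, δ_½)`, a rung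
reading patterns of radius `R ≥ δ` — below `δ_½` no smaller radius can work (`radius_ge_of_rungAt`). -/
theorem finiteRangeSplitting_iff_window :
    Summit.AtomisticToContinuum.Crystallization.Theses.FreeSplittingCertificates.FiniteRangeSplitting ↔
      ∀ δ : ℝ, 0 < δ → δ < halfSumThreshold → ∃ R : ℝ, δ ≤ R ∧ RungAt δ R := by
  rw [finiteRangeSplitting_iff_below (mem_rungSet_of_threshold_le le_rfl)]
  refine forall₂_congr fun δ hδ => forall_congr' fun hlt => ⟨?_, ?_⟩
  · rintro ⟨R, -, hr⟩
    exact ⟨R, radius_ge_of_rungAt hδ (not_halfSumFeasible_of_lt_threshold hlt) hr, hr⟩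
  · rintro ⟨R, hR, hr⟩
    exact ⟨R, hδ.trans_le hR, hr⟩

/-- In the window the witnessing rule is never the half rule: any rung at `δ < δ_½` is carried by a rule `Φ` that is
feasible where `halfRule` is not. -/
theorem finiteRangeSplitting_window_nonconstant
    (h : Summit.AtomisticToContinuum.Crystallization.Theses.FreeSplittingCertificates.FiniteRangeSplitting)
    {δ : ℝ} (hδ : 0 < δ) (hlt : δ < halfSumThreshold) :
    ∃ (R : ℝ) (Φ : EuclideanSpace ℝ (Fin 3) → Finset (EuclideanSpace ℝ (Fin 3)) → ℝ),
      δ ≤ R ∧ IsRule Φ ∧ Feasible δ R Φ ∧ ¬ Feasible δ R halfRule := by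
  obtain ⟨R, hR, Φ, hrule, hfeas⟩ := (finiteRangeSplitting_iff_window.1 h) δ hδ hlt
  exact ⟨R, Φ, hR, hrule, hfeas, fun hf =>
    not_halfSumFeasible_of_lt_threshold hlt ((feasible_halfRule_iff δ R).1 hf)⟩

/-! ## 3. The `ε`-analogue for crux r5 -/

/-- The hard cores carrying an `ε`-rung at some positive radius. [folklore] -/
def ARungSet (ε : ℝ) : Set ℝ := {δ : ℝ | 0 < δ ∧ ∃ R : ℝ, 0 < R ∧ ARungAt δ ε R}

/-- `ARungSet ε` is an up-set in `δ`. -/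
theorem mem_aRungSet_of_le {ε δ δ' : ℝ} (h : δ ∈ ARungSet ε) (hle : δ ≤ δ') : δ' ∈ ARungSet ε :=
  ⟨h.1.trans_le hle, h.2.imp fun _ hR => ⟨hR.1, arungAt_mono_sep hle hR.2⟩⟩

/-- `ARungSet` grows with `ε`. -/
theorem aRungSet_mono {ε ε' : ℝ} (h : ε ≤ ε') : ARungSet ε ⊆ ARungSet ε' :=
  fun _ hδ => ⟨hδ.1, hδ.2.imp fun _ hR => ⟨hR.1, arungAt_mono_eps h hR.2⟩⟩

/-- `RungSet ⊆ ARungSet ε` for `ε ≥ 0`. -/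
theorem rungSet_subset_aRungSet {ε : ℝ} (hε : 0 ≤ ε) : RungSet ⊆ ARungSet ε :=
  fun δ hδ => aRungSet_mono hε ⟨hδ.1, hδ.2.imp fun R hR => ⟨hR.1, (arungAt_zero_iff δ R).2 hR.2⟩⟩

/-- `ARungSet ε` is nonempty for `ε ≥ 0`. -/
theorem aRungSet_nonempty {ε : ℝ} (hε : 0 ≤ ε) : (ARungSet ε).Nonempty :=
  rungSet_nonempty.mono (rungSet_subset_aRungSet hε)

/-- `ARungSet ε` is bounded below by `0`. -/
theorem aRungSet_bddBelow (ε : ℝ) : BddBelow (ARungSet ε) :=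
  ⟨0, fun _ h => h.1.le⟩

/-- The critical hard core at tolerance `ε`: `δ_c(ε) := inf {δ > 0 | ∃ R > 0, ARungAt δ ε R}`. [folklore] -/
def critSepApprox (ε : ℝ) : ℝ := sInf (ARungSet ε)

/-- `0 ≤ δ_c(ε)` for `ε ≥ 0`. -/
theorem critSepApprox_nonneg {ε : ℝ} (hε : 0 ≤ ε) : 0 ≤ critSepApprox ε :=
  le_csInf (aRungSet_nonempty hε) fun _ h => h.1.le

/-- Members of `ARungSet ε` bound `δ_c(ε)` from above. -/
theorem critSepApprox_le_of_mem {ε δ : ℝ} (h : δ ∈ ARungSet ε) : critSepApprox ε ≤ δ :=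
  csInf_le (aRungSet_bddBelow ε) h

/-- `δ_c(ε) ≤ δ_c` for `ε ≥ 0`: tolerance only helps. -/
theorem critSepApprox_le_critSep {ε : ℝ} (hε : 0 ≤ ε) : critSepApprox ε ≤ critSep :=
  le_csInf rungSet_nonempty fun _ hδ => critSepApprox_le_of_mem (rungSet_subset_aRungSet hε hδ)

/-- `δ_c(·)` is antitone on `[0, ∞)`. -/
theorem critSepApprox_antitone {ε ε' : ℝ} (hε : 0 ≤ ε) (h : ε ≤ ε') : critSepApprox ε' ≤ critSepApprox ε :=
  le_csInf (aRungSet_nonempty hε) fun _ hδ => critSepApprox_le_of_mem (aRungSet_mono h hδ)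

/-- Every hard core strictly above `δ_c(ε)` carries an `ε`-rung (`ε ≥ 0`). -/
theorem mem_aRungSet_of_critSepApprox_lt {ε δ : ℝ} (hε : 0 ≤ ε) (h : critSepApprox ε < δ) : δ ∈ ARungSet ε := by
  obtain ⟨s, hs, hsδ⟩ := (csInf_lt_iff (aRungSet_bddBelow ε) (aRungSet_nonempty hε)).mp h
  exact mem_aRungSet_of_le hs hsδ.le

/-- **Crux r5 is the vanishing of every `δ_c(ε)`**: `ApproxFiniteRangeSplitting ↔ ∀ ε > 0, δ_c(ε) = 0`. -/
theorem approxFiniteRangeSplitting_iff_critSepApprox :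
    Summit.AtomisticToContinuum.Crystallization.Theses.FreeSplittingCertificates.ApproxFiniteRangeSplitting ↔
      ∀ ε : ℝ, 0 < ε → critSepApprox ε = 0 := by
  rw [approxFiniteRangeSplitting_iff_arung]
  constructor
  · intro h ε hε
    exact le_antisymm
      (le_of_forall_gt_imp_ge_of_dense fun δ hδ => critSepApprox_le_of_mem ⟨hδ, h δ hδ ε hε⟩)
      (critSepApprox_nonneg hε.le)
  · intro h δ hδ ε hε
    exact (mem_aRungSet_of_critSepApprox_lt hε.le ((h ε hε).symm ▸ hδ)).2

/-- Hence crux r2 implies crux r5 through the critical hard cores: `δ_c = 0 ⟹ δ_c(ε) = 0` for all `ε > 0`. -/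
theorem critSepApprox_eq_zero_of_critSep_eq_zero (h : critSep = 0) {ε : ℝ} (hε : 0 ≤ ε) : critSepApprox ε = 0 :=
  le_antisymm (h ▸ critSepApprox_le_critSep hε) (critSepApprox_nonneg hε)

end Summit.AtomisticToContinuum.Crystallization.Theorems.StrictSplittingRuleBirth

end
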